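import Summits.AnomalousDissipation.AnomalousDissipation.Theorems.SolenoidalFractalHomogenisationLagrangianStepCellLawVOddGainDefectStrict
import HarnessLib

/-!
# K1L `LagrangianRenormalisationStep(Design)` (K1L_D, stmt-AnomalousDissipation-27980; aside 24912), stub `stub_cellLawV0_IS`
# — W5 odd half, §5: THE WINDOW CLAUSE FOR SECTORIAL BLOCKS — the UPPER edge in full (no symmetry), the skew bound, and the typed lower-edge target

Summits-side helper/sketch of route `SolenoidalFractalHomogenisation` (planner ad-ideate-p5 g8, lens «profile»), on top of `…CellLawVOddGainDefectStrict`
(p650822) and the worker's `…CellLawVSemigroupPerp` (p642614) / `…CellLawVQSResp` (p643071).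
The remaining per-slot obligation of the strict twin `oddSectorial_excQS_strict_of_slot` is the transverse window of the quasi-static response
`f_T(B)` of a SECTORIAL (non-symmetric) block `B` with `lo|x|² ≤ xᵀBx ≤ hi|x|²` and Kato sector `τ`.  PROVED here, sorry-free:
* `form_exp_le_of_coercive` — `vᵀe^{−tB}v ≤ e^{−lo t}|v|²` for EVERY block with `lo|x|² ≤ xᵀBx` (contractivity p642614 at `u = 0` + Cauchy–Schwarz);
* **`qsResp_window_upper`** — hence the UPPER window edge `vᵀ f_T(B) v ≤ f_T(lo)|v|²` holds for sectorial blocks with NO loss (`T ≥ 0`);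
* **`skew_sq_le_of_sector`** — the sector hypothesis controls the skew part: `|(B − Bᵀ)z|² ≤ (τ·hi)²|z|²` (test the sector inequality at `x = (B − Bᵀ)z`).
TYPED TARGET (the lower edge, first order in `τ`; statement only, as `def …_Target : Prop`, no sorry, nothing claimed):
* `LowerEdgeTarget ρ` — `∀ T ≥ 0, ∀ B` (window `[lo, hi]`, sector `τ`), `∀ v`, `vᵀ f_T(B) v ≥ (f_T(hi) − (τ·hi/2)·g_T(lo))·|v|²` with
  `g_T(a) = T∫₀¹a(s)∫₀ˢa(x)·T(s−x)·e^{−T(s−x)a}` (`= −∂_a f_T`); route: energy estimate for `w = e^{−tB}v − e^{−tH}v`, `H = (B+Bᵀ)/2`: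
  `|w(t)| ≤ (τhi/2)·t·e^{−lo t}|v|` (uses `skew_sq_le_of_sector`), then the symmetric pinch on `H` and the kernel integration of p643071.
  Relative loss of the lower edge `τ·hi²/(2lo²)` (first order); the true loss is `O(τ²)` (the first Duhamel term of the quadratic form vanishes
  under `s ↦ t − s`) — numbers in the memo `Cruxes/…/OddGain-Defect.md` (kit j313542).
No named facts, no sorry.  NOT a proof of the stub, of the crux, of Onsager's conjecture or of anomalous dissipation — rung-leaf F-D1.A0 algebra.
-/

set_option linter.dupNamespace false

noncomputable section

namespace Summit.AnomalousDissipation.AnomalousDissipation.Theorems.SolenoidalFractalHomogenisation.LagrangianStep.OddGain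

open Matrix Finset

section Sectorial

open Literature.Analysis Literature.Analysis.FunctionSpaces Literature.Analysis.FluidPDE
open Literature.Analysis.FluidPDE.LatticeShear

/-- `x·x = Σ xᵢ²` (local copy; `…OddGainDefectWindows` has the same fact as `dotProduct_self_eq_sum_sq`). -/
theorem self_dotProduct_eq_sum_sq (x : Fin 3 → ℝ) : x ⬝ᵥ x = ∑ i, x i ^ 2 := by
  simp [dotProduct, sq]

/-- **Contractivity ⇒ upper semigroup bound for the quadratic form, NO symmetry**: `lo|x|² ≤ xᵀBx` for all `x` gives
`vᵀe^{−tB}v ≤ e^{−lo t}|v|²` (`t ≥ 0`): `|e^{−tB}v| ≤ e^{−lo t}|v|` (p642614, invariant hyperplane `u = 0`) and Cauchy–Schwarz. [folklore] -/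
theorem form_exp_le_of_coercive {B : Matrix (Fin 3) (Fin 3) ℝ} {lo : ℝ} (hwin : ∀ x : Fin 3 → ℝ, lo * (x ⬝ᵥ x) ≤ x ⬝ᵥ B *ᵥ x)
    (v : Fin 3 → ℝ) {t : ℝ} (ht : 0 ≤ t) :
    ∑ i, v i * (NormedSpace.exp (-(t • B))).mulVec v i ≤ Real.exp (-(lo * t)) * ∑ i, v i ^ 2 := by
  have hu : ∀ j, ∑ i, (0 : Fin 3 → ℝ) i * B i j = 0 * (0 : Fin 3 → ℝ) j := by intro j; simp
  have hlo : ∀ w : Fin 3 → ℝ, ∑ i, (0 : Fin 3 → ℝ) i * w i = 0 → lo * ∑ i, w i ^ 2 ≤ ∑ i, ∑ j, w i * B i j * w j := by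
    intro w _; rw [sum_sum_eq_form, ← self_dotProduct_eq_sum_sq]; exact hwin w
  have hv : ∑ i, (0 : Fin 3 → ℝ) i * v i = 0 := by simp
  set z := (NormedSpace.exp (-(t • B))).mulVec v with hz
  have hcontr : ∑ i, z i ^ 2 ≤ Real.exp (-(2 * lo * t)) * ∑ i, v i ^ 2 :=
    sum_sq_exp_neg_smul_mulVec_le_of_perp B hu hlo hv ht
  have hv0 : 0 ≤ ∑ i, v i ^ 2 := Finset.sum_nonneg fun i _ => sq_nonneg _
  have hcs : (∑ i, v i * z i) ^ 2 ≤ (∑ i, v i ^ 2) * ∑ i, z i ^ 2 := Finset.sum_mul_sq_le_sq_mul_sq _ _ _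
  have hsq : (∑ i, v i * z i) ^ 2 ≤ (Real.exp (-(lo * t)) * ∑ i, v i ^ 2) ^ 2 := by
    have hexp : Real.exp (-(2 * lo * t)) = Real.exp (-(lo * t)) ^ 2 := by
      rw [sq, ← Real.exp_add]; ring_nf
    calc (∑ i, v i * z i) ^ 2 ≤ (∑ i, v i ^ 2) * ∑ i, z i ^ 2 := hcs
      _ ≤ (∑ i, v i ^ 2) * (Real.exp (-(2 * lo * t)) * ∑ i, v i ^ 2) := mul_le_mul_of_nonneg_left hcontr hv0
      _ = (Real.exp (-(lo * t)) * ∑ i, v i ^ 2) ^ 2 := by rw [hexp]; ring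
  have hnn : 0 ≤ Real.exp (-(lo * t)) * ∑ i, v i ^ 2 := mul_nonneg (Real.exp_pos _).le hv0
  exact (abs_le.mp (abs_le_of_sq_le_sq hsq hnn)).2

/-- **THE UPPER WINDOW EDGE FOR SECTORIAL BLOCKS, no loss**: `lo|x|² ≤ xᵀBx` for all `x` and `T ≥ 0` give `vᵀ f_T(B) v ≤ f_T(lo)|v|²`
(`f_T = qsRespScalar ρ T`) for EVERY (not necessarily symmetric) block — the upper half of the window clause of
`oddSectorial_excQS_strict_of_slot` costs nothing in `τ`. [folklore] -/
theorem qsResp_window_upper {ρ T lo : ℝ} (hT : 0 ≤ T) {B : Matrix (Fin 3) (Fin 3) ℝ}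
    (hwin : ∀ x : Fin 3 → ℝ, lo * (x ⬝ᵥ x) ≤ x ⬝ᵥ B *ᵥ x) (v : Fin 3 → ℝ) :
    v ⬝ᵥ (qsResp ρ T B) *ᵥ v ≤ qsRespScalar ρ T lo * (v ⬝ᵥ v) := by
  have upp := sum_sum_mul_qsResp_mul_le (ρ := ρ) hT (fun t ht => form_exp_le_of_coercive hwin v ht)
  rw [sum_sum_eq_form, ← self_dotProduct_eq_sum_sq] at upp
  exact upp

/-- … on `P_s`-projected vectors, in the `perpSq` currency: `(P_s x)ᵀ f_T(B) (P_s x) ≤ f_T(lo)|P_s x|²`. [folklore] -/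
theorem qsResp_window_upper_projPerp {ρ T lo : ℝ} (hT : 0 ≤ T) {B : Matrix (Fin 3) (Fin 3) ℝ}
    (hwin : ∀ x : Fin 3 → ℝ, lo * (x ⬝ᵥ x) ≤ x ⬝ᵥ B *ᵥ x) (s : Fin 26) (x : Fin 3 → ℝ) :
    ((projPerp (slotN s)) *ᵥ x) ⬝ᵥ (qsResp ρ T B) *ᵥ ((projPerp (slotN s)) *ᵥ x) ≤ qsRespScalar ρ T lo * perpSq (slotN s) x := by
  have hn : ∑ a, slotN s a ^ 2 = 1 := by rw [← self_dotProduct_eq_sum_sq]; exact slotN_unit s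
  rw [← perpSq_eq_projPerp (slotN s) x hn]
  exact qsResp_window_upper hT hwin _

/-- `zᵀBx = xᵀBᵀz`. -/
theorem form_comm_transpose (B : Matrix (Fin 3) (Fin 3) ℝ) (x z : Fin 3 → ℝ) : z ⬝ᵥ B *ᵥ x = x ⬝ᵥ Bᵀ *ᵥ z := by
  rw [Matrix.mulVec_transpose, Matrix.dotProduct_mulVec, dotProduct_comm]

/-- **The sector hypothesis bounds the skew part**: `(xᵀBz − zᵀBx)² ≤ τ²·xᵀBx·zᵀBz` (all `x, z`) and the window `lo|x|² ≤ xᵀBx ≤ hi|x|²`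
(`lo ≥ 0`) give `|(B − Bᵀ)z|² ≤ (τ·hi)²·|z|²`, i.e. `‖K‖ ≤ τ·hi/2` for `K = (B − Bᵀ)/2` (test the sector inequality at `x = (B − Bᵀ)z`). [folklore] -/
theorem skew_sq_le_of_sector {B : Matrix (Fin 3) (Fin 3) ℝ} {τ lo hi : ℝ} (hlo : 0 ≤ lo)
    (hsec : ∀ x z : Fin 3 → ℝ, (x ⬝ᵥ B *ᵥ z - z ⬝ᵥ B *ᵥ x) ^ 2 ≤ τ ^ 2 * ((x ⬝ᵥ B *ᵥ x) * (z ⬝ᵥ B *ᵥ z)))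
    (hwin : ∀ x : Fin 3 → ℝ, lo * (x ⬝ᵥ x) ≤ x ⬝ᵥ B *ᵥ x ∧ x ⬝ᵥ B *ᵥ x ≤ hi * (x ⬝ᵥ x)) (z : Fin 3 → ℝ) :
    (B *ᵥ z - Bᵀ *ᵥ z) ⬝ᵥ (B *ᵥ z - Bᵀ *ᵥ z) ≤ (τ * hi) ^ 2 * (z ⬝ᵥ z) := by
  set w := B *ᵥ z - Bᵀ *ᵥ z with hw
  have hkey : w ⬝ᵥ B *ᵥ z - z ⬝ᵥ B *ᵥ w = w ⬝ᵥ w := by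
    rw [form_comm_transpose B w z, hw, dotProduct_sub]
  have h1 := hsec w z
  rw [hkey] at h1
  have hnn : ∀ x : Fin 3 → ℝ, 0 ≤ x ⬝ᵥ x := fun x => by
    rw [self_dotProduct_eq_sum_sq]; exact Finset.sum_nonneg fun i _ => sq_nonneg _
  have hw0 := hnn w
  have hz0 := hnn z
  have hBw0 : 0 ≤ w ⬝ᵥ B *ᵥ w := (mul_nonneg hlo hw0).trans (hwin w).1
  have hBz0 : 0 ≤ z ⬝ᵥ B *ᵥ z := (mul_nonneg hlo hz0).trans (hwin z).1
  have hhi0 : 0 ≤ hi * (w ⬝ᵥ w) := hBw0.trans (hwin w).2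
  have hprod : (w ⬝ᵥ B *ᵥ w) * (z ⬝ᵥ B *ᵥ z) ≤ (hi * (w ⬝ᵥ w)) * (hi * (z ⬝ᵥ z)) :=
    mul_le_mul (hwin w).2 (hwin z).2 hBz0 hhi0
  have h2 : (w ⬝ᵥ w) ^ 2 ≤ ((τ * hi) ^ 2 * (z ⬝ᵥ z)) * (w ⬝ᵥ w) := by
    calc (w ⬝ᵥ w) ^ 2 ≤ τ ^ 2 * ((w ⬝ᵥ B *ᵥ w) * (z ⬝ᵥ B *ᵥ z)) := h1
      _ ≤ τ ^ 2 * ((hi * (w ⬝ᵥ w)) * (hi * (z ⬝ᵥ z))) := mul_le_mul_of_nonneg_left hprod (sq_nonneg _)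
      _ = ((τ * hi) ^ 2 * (z ⬝ᵥ z)) * (w ⬝ᵥ w) := by ring
  rcases hw0.lt_or_eq with hpos | hzero
  · rw [sq] at h2
    exact le_of_mul_le_mul_right h2 hpos
  · rw [← hzero]
    exact mul_nonneg (sq_nonneg _) hz0

/-! ### The typed lower-edge target (statement only; first order in `τ`) -/

/-- The kernel-weighted first moment `g_T(a) = T ∫₀¹ a(s) ∫₀ˢ a(x) · T(s−x) · e^{−T(s−x)a} dx ds` (`= −∂_a f_T(a)`; for `T a ≫ 1`, `g_T(a) → ϑ_∞/a²`). -/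
def qsRespMoment (ρ T a : ℝ) : ℝ :=
  T * ∫ s in (0:ℝ)..1, LatticeShear.LatticeWord.trapezoid 0 1 ρ s *
    ∫ x in (0:ℝ)..s, LatticeShear.LatticeWord.trapezoid 0 1 ρ x * ((T * (s - x)) * Real.exp (-(T * (s - x)) * a))

/-- **TYPED TARGET (not proved here): the LOWER window edge for sectorial blocks, first order in `τ`.**  For `T ≥ 0`, a block `B` in the
Kato sector `τ` with window `[lo, hi]` (`0 < lo`), and every `v`: `vᵀ f_T(B) v ≥ (f_T(hi) − (τ·hi/2)·g_T(lo))·|v|²`.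
Route: `H = (B + Bᵀ)/2` is symmetric with the same window; `w(t) = e^{−tB}v − e^{−tH}v` solves `w' = −Bw − K e^{−tH}v` (`K = (B − Bᵀ)/2`,
`|Kx| ≤ (τhi/2)|x|` by `skew_sq_le_of_sector`), so `d/dt(e^{lo t}|w|) ≤ (τhi/2)|v|` and `|w(t)| ≤ (τhi/2)·t·e^{−lo t}|v|`; then
`vᵀe^{−tB}v ≥ vᵀe^{−tH}v − |v||w(t)| ≥ (e^{−hi t} − (τhi/2) t e^{−lo t})|v|²` (symmetric pinch p642614 on `H`) and the kernel integration of
p643071 (a two-rate variant of `le_sum_sum_mul_qsResp_mul`).  With `g_T(lo) ≤ ϑ_∞/lo²` and `f_T(hi) ≈ ϑ_∞/hi` the relative loss of the lower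
edge is `τ·hi²/(2lo²)` — the design number of the memo.  (The true loss is `O(τ²)`.) -/
def LowerEdgeTarget (ρ : ℝ) : Prop :=
  ∀ T : ℝ, 0 ≤ T → ∀ (B : Matrix (Fin 3) (Fin 3) ℝ) (τ lo hi : ℝ), 0 ≤ τ → 0 < lo →
    (∀ x z : Fin 3 → ℝ, (x ⬝ᵥ B *ᵥ z - z ⬝ᵥ B *ᵥ x) ^ 2 ≤ τ ^ 2 * ((x ⬝ᵥ B *ᵥ x) * (z ⬝ᵥ B *ᵥ z))) →
    (∀ x : Fin 3 → ℝ, lo * (x ⬝ᵥ x) ≤ x ⬝ᵥ B *ᵥ x ∧ x ⬝ᵥ B *ᵥ x ≤ hi * (x ⬝ᵥ x)) →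
    ∀ v : Fin 3 → ℝ, (qsRespScalar ρ T hi - τ * hi / 2 * qsRespMoment ρ T lo) * (v ⬝ᵥ v) ≤ v ⬝ᵥ (qsResp ρ T B) *ᵥ v

/-- **How the target closes the window clause** (bookkeeping, proved): `LowerEdgeTarget` + `qsResp_window_upper` give, for every sectorial block
of slot `s`, the transverse window `[f_T(hi) − (τhi/2) g_T(lo), f_T(lo)]·|P_s x|²` — the extra clause of `oddSectorial_excQS_strict_of_slot`
in the slot-dependent form consumed by `oddSectorial_excQS_strict_of_slotWindows`. [folklore] -/
theorem window_clause_of_lowerEdgeTarget {ρ : ℝ} (hLE : LowerEdgeTarget ρ) {T : ℝ} (hT : 0 ≤ T) {B : Matrix (Fin 3) (Fin 3) ℝ}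
    {τ lo hi : ℝ} (hτ : 0 ≤ τ) (hlo : 0 < lo)
    (hsec : ∀ x z : Fin 3 → ℝ, (x ⬝ᵥ B *ᵥ z - z ⬝ᵥ B *ᵥ x) ^ 2 ≤ τ ^ 2 * ((x ⬝ᵥ B *ᵥ x) * (z ⬝ᵥ B *ᵥ z)))
    (hwin : ∀ x : Fin 3 → ℝ, lo * (x ⬝ᵥ x) ≤ x ⬝ᵥ B *ᵥ x ∧ x ⬝ᵥ B *ᵥ x ≤ hi * (x ⬝ᵥ x)) (s : Fin 26) (x : Fin 3 → ℝ) :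
    (qsRespScalar ρ T hi - τ * hi / 2 * qsRespMoment ρ T lo) * perpSq (slotN s) x ≤
      ((projPerp (slotN s)) *ᵥ x) ⬝ᵥ (qsResp ρ T B) *ᵥ ((projPerp (slotN s)) *ᵥ x) ∧
    ((projPerp (slotN s)) *ᵥ x) ⬝ᵥ (qsResp ρ T B) *ᵥ ((projPerp (slotN s)) *ᵥ x) ≤ qsRespScalar ρ T lo * perpSq (slotN s) x := by
  have hn : ∑ a, slotN s a ^ 2 = 1 := by rw [← self_dotProduct_eq_sum_sq]; exact slotN_unit s
  refine ⟨?_, qsResp_window_upper_projPerp hT (fun x => (hwin x).1) s x⟩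
  rw [← perpSq_eq_projPerp (slotN s) x hn]
  exact hLE T hT B τ lo hi hτ hlo hsec hwin _

/-- **TYPED TARGET, SHARP FORM (not proved here; constant from the profile j313542 and the static limit):** for `T ≥ 0`, a block `B` in the
Kato sector `τ` with window `[lo, hi]` (`0 < lo`), and every `v`: `vᵀ f_T(B) v ≥ f_T(hi)/(1 + τ²/4)·|v|²`.  Numerically attained as `T → ∞` by
`B = hi·(𝟙 + (τ/2)[u]_×)`; for finite `T` the measured loss is smaller (`0.21τ²` at `T = 16`).  Static-limit mechanism: for `A` skew with
`‖A‖ ≤ τ/2`, `sym((𝟙 + A)⁻¹) = (𝟙 − A²)⁻¹ ≥ 𝟙/(1 + τ²/4)`. -/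
def LowerEdgeTargetSharp (ρ : ℝ) : Prop :=
  ∀ T : ℝ, 0 ≤ T → ∀ (B : Matrix (Fin 3) (Fin 3) ℝ) (τ lo hi : ℝ), 0 ≤ τ → 0 < lo →
    (∀ x z : Fin 3 → ℝ, (x ⬝ᵥ B *ᵥ z - z ⬝ᵥ B *ᵥ x) ^ 2 ≤ τ ^ 2 * ((x ⬝ᵥ B *ᵥ x) * (z ⬝ᵥ B *ᵥ z))) →
    (∀ x : Fin 3 → ℝ, lo * (x ⬝ᵥ x) ≤ x ⬝ᵥ B *ᵥ x ∧ x ⬝ᵥ B *ᵥ x ≤ hi * (x ⬝ᵥ x)) →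
    ∀ v : Fin 3 → ℝ, qsRespScalar ρ T hi / (1 + τ ^ 2 / 4) * (v ⬝ᵥ v) ≤ v ⬝ᵥ (qsResp ρ T B) *ᵥ v

/-- **How the sharp target closes the window clause** (bookkeeping, proved): the slot window `[f_T(hi)/(1 + τ²/4), f_T(lo)]·|P_s x|²`, i.e. the
box ratio of `oddSectorial_excQS_strict_of_slotWindows` is the symmetric one times `(1 + τ²/4)`. [folklore] -/
theorem window_clause_of_lowerEdgeTargetSharp {ρ : ℝ} (hLE : LowerEdgeTargetSharp ρ) {T : ℝ} (hT : 0 ≤ T) {B : Matrix (Fin 3) (Fin 3) ℝ}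
    {τ lo hi : ℝ} (hτ : 0 ≤ τ) (hlo : 0 < lo)
    (hsec : ∀ x z : Fin 3 → ℝ, (x ⬝ᵥ B *ᵥ z - z ⬝ᵥ B *ᵥ x) ^ 2 ≤ τ ^ 2 * ((x ⬝ᵥ B *ᵥ x) * (z ⬝ᵥ B *ᵥ z)))
    (hwin : ∀ x : Fin 3 → ℝ, lo * (x ⬝ᵥ x) ≤ x ⬝ᵥ B *ᵥ x ∧ x ⬝ᵥ B *ᵥ x ≤ hi * (x ⬝ᵥ x)) (s : Fin 26) (x : Fin 3 → ℝ) :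
    qsRespScalar ρ T hi / (1 + τ ^ 2 / 4) * perpSq (slotN s) x ≤
      ((projPerp (slotN s)) *ᵥ x) ⬝ᵥ (qsResp ρ T B) *ᵥ ((projPerp (slotN s)) *ᵥ x) ∧
    ((projPerp (slotN s)) *ᵥ x) ⬝ᵥ (qsResp ρ T B) *ᵥ ((projPerp (slotN s)) *ᵥ x) ≤ qsRespScalar ρ T lo * perpSq (slotN s) x := by
  have hn : ∑ a, slotN s a ^ 2 = 1 := by rw [← self_dotProduct_eq_sum_sq]; exact slotN_unit s
  refine ⟨?_, qsResp_window_upper_projPerp hT (fun x => (hwin x).1) s x⟩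
  rw [← perpSq_eq_projPerp (slotN s) x hn]
  exact hLE T hT B τ lo hi hτ hlo hsec hwin _

end Sectorial

end Summit.AnomalousDissipation.AnomalousDissipation.Theorems.SolenoidalFractalHomogenisation.LagrangianStep.OddGain

end
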